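import Summits.BirchSwinnertonDyer.BirchSwinnertonDyer.Theorems.ByReductionTypeAtTwoAdditivePotGoodPrintZhaiIrreducibleCorrected
import Summits.BirchSwinnertonDyer.BirchSwinnertonDyer.Theorems.ByReductionTypeAtTwoAdditivePotGoodLowerHalfFrontierRows
import Summits.BirchSwinnertonDyer.BirchSwinnertonDyer.Theorems.EisensteinDepletionAtTwoDepletedLawCFLowerHalf
import Summits.BirchSwinnertonDyer.Rank1Residual.AdditivePotMult.RankZeroKimNakamuraIntModel
import Literature.NumberTheory.DiophantineGeometry.EllArithGlueProofs
import Literature.NumberTheory.DiophantineGeometry.MinimalDiscriminantFiniteProofs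
import Summits.BirchSwinnertonDyer.Uniform.U2.CubicFieldInertOddTrace
import Summits.BirchSwinnertonDyer.Rank1Residual.Supersingular.RationalLadder
import HarnessLib

/-!
# K4 crux `AdditiveRankZeroAtTwo` (19098), child C3″ `AdditivePotGoodLowerHalfAtTwo` (22617): the ZHAI 2016 print road at the bases
# `200E1`, `116B1`, `540A1` of Cremona's Table 1 (Thm. 1.1, `Δ < 0`) — file B

Cell `bsd-2adic`, seat `bsd-2adic-k4-w2` GEN 6 (prover, explicit unit, no kit); `--supports stmt-BirchSwinnertonDyer-22617 --as helper`;
companion of `…AdditivePotGoodPrintZhaiIrreducible.lean` (the generic road `printFamilyZhai11_lower` / `printFamilyZhai12_lower`).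
HONEST FRAMING (D-0036/D-0054): for each base `V` the KERNEL decides ellipticity, global minimality (Kraus–Silverman certificate), the sign
of `Δ`, `V[2]` irreducible (root-free `2`-division cubic modulo a small prime), `ord₂ j(V)` exactly (inside the window `[1, 11]`: `V` and all
its twists by `M ≡ 1 (mod 4)` are ADDITIVE and POTENTIALLY GOOD at `2`) and non-CM; DISPLAYED, exactly as Zhai's theorem takes them, are the
`X₀(N)`-optimality datum (`Dt`, `hopt` — the bases are the FIRST curves of their classes in Cremona's 1992 Table 1, i.e. the «strong Weil
curves») and the record `ord₂(L(V,1)/Ω_∞(V)) = 0` (resp. `= 1` for `Δ > 0`), read off Cremona's Tables 1 and 4 (`r = 0`, `S = 1` for every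
`N ≤ 1000` except `571A, 681B, 960D, 960N`; `L(V,1)/Ω_BSD = S·∏c_p/#T²` odd; `Ω_BSD = c_∞·Ω_∞`). The road is keyed on Zhai's CORRECTED
statements (arXiv v2: odd Manin constant; the tree's primed facts `Zhai2016.thm11_…'` / `thm12_…'`, ERRATUM file of the b2b cell), the
Manin binder supplied BY PRINT (Agashe–Ribet–Stein 2006 Thm. 2.6, `h26`) from the KERNEL level bound `N(V) ≤ 130000`
(`N ∣ |Δ_min|`; for `196B1`, `676D1` sharpened by `f_ℓ ≤ 2`, `ℓ ≥ 5`). Labels are those of the 1992 first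
edition (held text `book:cremona1997-…`, Table 1 pp. for `N = 104, 116, 124, 196, 200, 540, 676`); the curves are pinned by their
a-invariants. OUTPUT per base: at EVERY global minimal `W ≅ V^{(M)}` (`M` as in Zhai's Thm. 1.1 / 1.2) the C3″ binders are decided
(`r_an(W) = 0`, `Addv W 2`, `0 ≤ ord₂ j`, `¬CM`, `Irr W 2`) and the LOWER half `MissingLowerBoundAt W 2` HOLDS. Inputs BY NAME: Zhai 2016
Thm. 1.1 / 1.2 CORRECTED (flag-free at `2`, analytic rank zero), Agashe–Ribet–Stein Thm. 2.6, modularity. NO GZK, no reading, no instrument, no base certificate. These are the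
first intrinsically-additive `E[2]`-IRREDUCIBLE print families of the K4 additive block (GEN 5's was the `C₂`-type `37a1^{(−m)}`);
disjoint from the cell's residual census (`ord₂ #Ш_an ≤ 0` here). Closes nothing at the `∀`-level; nothing booked; BSD is not proved by
any of this. References: [Zhai2016] Thms. 1.1–1.2; [CremonaAlgorithms1997] Tables 1, 4; [SilvermanAEC2009] III.1, III.2.3, VII.1, VII.5,
App. C §11; [Kraus1989] Prop. 1–2; [Miller2011LMS] Def. 1.1.
-/

set_option autoImplicit false
-- the Theorems namespace of this sub repeats the summit name by design (D-0017 nested layout)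
set_option linter.dupNamespace false

noncomputable section

open scoped Classical

open WeierstrassCurve Literature.NumberTheory.EllipticCurves
  Literature.NumberTheory.EllipticCurves.ModularForms
  Literature.NumberTheory.EllipticCurves.Rank1Residual
  Literature.NumberTheory.EllipticCurves.Rank1Residual.Typed
  Literature.NumberTheory.EllipticCurves.CoatesLiTianZhai2015
  Literature.NumberTheory.EllipticCurves.Zhai2016
  Literature.NumberTheory.EllipticCurves.AgasheRibetStein2006
  Summit.BirchSwinnertonDyer
  Summit.BirchSwinnertonDyer.Rank1Residual
  Summit.BirchSwinnertonDyer.Rank1Residual.X11b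
  Summit.BirchSwinnertonDyer.Rank1Residual.X5.O1
  Summit.BirchSwinnertonDyer.Rank1Residual.P2
  Summit.BirchSwinnertonDyer.BirchSwinnertonDyer.Rank1Residual.IntModel
  Summit.BirchSwinnertonDyer.BirchSwinnertonDyer.Theorems

namespace Summit.BirchSwinnertonDyer.BirchSwinnertonDyer.Theorems.AddPotGoodPrint

/-! ## Base `200E1` = `[0, 0, 0, 5, -10]` (Cremona 1992 Table 1: `N = 200 = 2³·5²`, `r = 0`, `#T = 1`, `c_p = (1, 1)`, Kodaira `II*, II`;
Table 4: `S = 1`), `Δ = -51200` (-), `j = 270` (`ord₂ j = 1`), Zhai Thm. 1.1 -/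
section Base200E1

/-- `200E1 = [0, 0, 0, 5, -10]` is an elliptic curve (`Δ = -51200 ≠ 0`). [cite: CremonaAlgorithms1997, Table 1] -/
theorem isElliptic_200E1 : (⟨0, 0, 0, 5, -10⟩ : WeierstrassCurve ℚ).IsElliptic := ⟨by
  rw [isUnit_iff_ne_zero]; norm_num [WeierstrassCurve.Δ, WeierstrassCurve.b₂, WeierstrassCurve.b₄, WeierstrassCurve.b₆, WeierstrassCurve.b₈]⟩

/-- `200E1` is GLOBALLY MINIMAL (`|Δ| = 51200`: `v_p Δ < 12` at every prime; Kraus at `2`, Silverman at odd `p`).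
[cite: SilvermanAEC2009, VII.1 Remark 1.1] [cite: Kraus1989, Prop. 1 and Prop. 2] -/
theorem isGloballyMinimal_200E1 : (⟨0, 0, 0, 5, -10⟩ : WeierstrassCurve ℚ).IsGloballyMinimal :=
  isGloballyMinimal_of_krausCriterion_support (0) (0) (0) (5) (-10) [(2, 0, 11), (5, 0, 2)]
    (by intro t ht; simp only [List.mem_cons, List.not_mem_nil, or_false] at ht
        rcases ht with rfl | rfl <;> norm_num)
    (by decide +kernel) (by decide +kernel)

/-- `Δ(200E1) = -51200` on the integer model. [cite: CremonaAlgorithms1997, Table 1] -/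
theorem M200E1_Δ : (⟨0, 0, 0, 5, -10⟩ : WeierstrassCurve ℤ).Δ = -51200 := by decide +kernel
/-- `c₄(200E1) = -240` on the integer model. [cite: CremonaAlgorithms1997, Table 1] -/
theorem M200E1_c₄ : (⟨0, 0, 0, 5, -10⟩ : WeierstrassCurve ℤ).c₄ = -240 := by decide +kernel
/-- `Δ(200E1) < 0` (rational model). [cite: CremonaAlgorithms1997, Table 1] -/
theorem Δ_sign_200E1 : (⟨0, 0, 0, 5, -10⟩ : WeierstrassCurve ℚ).Δ < 0 := by
  norm_num [WeierstrassCurve.Δ, WeierstrassCurve.b₂, WeierstrassCurve.b₄, WeierstrassCurve.b₆, WeierstrassCurve.b₈]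

/-- The integer model of `200E1` is Cremona's. [cite: SilvermanAEC2009, VIII.8] -/
theorem intModel_200E1 :
    haveI := isElliptic_200E1; haveI := isGloballyMinimal_200E1
    integralModelInt (⟨0, 0, 0, 5, -10⟩ : WeierstrassCurve ℚ) = (⟨0, 0, 0, 5, -10⟩ : WeierstrassCurve ℤ) :=
  haveI := isElliptic_200E1; haveI := isGloballyMinimal_200E1
  integralModelInt_eq_of_map_eq _ (by ext <;> simp [WeierstrassCurve.map])

/-- `b₂, b₄, b₆` of `200E1`. [cite: SilvermanAEC2009, III.1] -/
theorem b_200E1 : (⟨0, 0, 0, 5, -10⟩ : WeierstrassCurve ℚ).b₂ = ((0 : ℤ) : ℚ) ∧ (⟨0, 0, 0, 5, -10⟩ : WeierstrassCurve ℚ).b₄ = ((10 : ℤ) : ℚ) ∧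
    (⟨0, 0, 0, 5, -10⟩ : WeierstrassCurve ℚ).b₆ = ((-40 : ℤ) : ℚ) := by
  simp only [WeierstrassCurve.b₂, WeierstrassCurve.b₄, WeierstrassCurve.b₆]; norm_num

/-- **`E[2]` irreducible for `200E1`** (`E[2](ℚ) = 0`): the monic `2`-division cubic `X³ + b₂X² + 8b₄X + 16b₆` has no root
modulo `3`. [cite: SilvermanAEC2009, III.2.3 (b)] [cite: Zhai2016, Thm. 1.1 (hypothesis E[2](ℚ) = 0)] -/
theorem irr_two_200E1 :
    haveI := isElliptic_200E1
    Irr (⟨0, 0, 0, 5, -10⟩ : WeierstrassCurve ℚ) 2 :=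
  haveI := isElliptic_200E1
  irr_two_of_forall_cubic_ne _ b_200E1.1 b_200E1.2.1 b_200E1.2.2 (ℓ := 3) (by decide)

/-- **`ord₂ j(200E1) = 1`** (`2⁴ ∥ c₄ = -240`, `2^11 ∥ Δ`): inside the window `[1, 11]`, so `200E1` and every twist
`200E1^{(M)}` are ADDITIVE and POTENTIALLY GOOD at `2`. [cite: SilvermanAEC2009, III.1 and VII.5 Prop. 5.5] -/
theorem padicValRat_j_200E1 :
    haveI := isElliptic_200E1
    padicValRat 2 (⟨0, 0, 0, 5, -10⟩ : WeierstrassCurve ℚ).j = 1 := by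
  haveI : Fact (Nat.Prime 2) := ⟨Nat.prime_two⟩
  haveI := isElliptic_200E1; haveI := isGloballyMinimal_200E1
  rw [AdditivePotMult.padicValRat_j_eq_of_intModel intModel_200E1 2 4 11 (by rw [M200E1_c₄]; decide) (by rw [M200E1_c₄]; decide)
    (by rw [M200E1_Δ]; decide) (by rw [M200E1_Δ]; decide)]
  norm_num

/-- **`N(200E1) ∣ |Δ_min| = 51200`** (the conductor divides the minimal discriminant). [cite: SilvermanAEC2009, VIII.11 and C.16] -/
theorem conductorNorm_dvd_200E1 :
    haveI := isElliptic_200E1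
    (⟨0, 0, 0, 5, -10⟩ : WeierstrassCurve ℚ).conductorNorm ℤ ∣ 51200 := by
  haveI := isElliptic_200E1; haveI := isGloballyMinimal_200E1
  have hdvd := WeierstrassCurve.conductorNorm_dvd_minimalDiscriminantNorm (⟨0, 0, 0, 5, -10⟩ : WeierstrassCurve ℚ)
    (WeierstrassCurve.finite_setOf_ordMinimalDiscriminant_ne_zero_holds _)
  rw [WeierstrassCurve.minimalDiscriminantNorm_int_eq_natAbs_minimalDiscriminantInt_holds,
    minimalDiscriminantInt_eq intModel_200E1, M200E1_Δ] at hdvd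
  exact hdvd

/-- **`N(200E1) ≤ 130000`** (`N ∣ 51200`; Cremona: `N = 200`, not needed) — the level bound feeding Agashe–Ribet–Stein Thm. 2.6.
[cite: AgasheRibetStein2006, Thm. 2.6] -/
theorem conductorNorm_le_200E1 :
    haveI := isElliptic_200E1
    (⟨0, 0, 0, 5, -10⟩ : WeierstrassCurve ℚ).conductorNorm ℤ ≤ 130000 :=
  le_trans (Nat.le_of_dvd (by norm_num) conductorNorm_dvd_200E1) (by norm_num)
/-- **`200E1` is non-CM**: `ord₂ j = 1 ∈ {1,2,5,7,8,9,10,11}` (k4-w1's window: no CM `j`-invariant has such a `2`-adic valuation). [cite: SilvermanAEC2009, App. C §11] -/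
theorem not_hasCM_200E1 :
    haveI := isElliptic_200E1
    ¬ (⟨0, 0, 0, 5, -10⟩ : WeierstrassCurve ℚ).HasCM := by
  haveI : Fact (Nat.Prime 2) := ⟨Nat.prime_two⟩
  haveI := isElliptic_200E1; haveI := isGloballyMinimal_200E1
  exact not_hasCM_of_padicValRat_two_j_mem _ (by rw [padicValRat_j_200E1]; decide)

/-- **THE ZHAI-1.1 ROAD AT THE BASE `200E1`**: for every `M` as in Zhai 2016 Thm. 1.1 (square-free,
`M ≡ 1 (mod 4)`, `(M, N) = 1`, `r ≥ 1` odd prime factors all inert in the cubic `2`-division field `F` of `200E1`) and every global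
minimal `W ≅ 200E1^{(M)}`: `r_an(W) = 0`, `W` is ADDITIVE and POTENTIALLY GOOD at `2`, NON-CM, `W[2]` IRREDUCIBLE, and the LOWER
half `MissingLowerBoundAt W 2` of BSD₂ HOLDS. KERNEL: ellipticity, global minimality, `Δ < 0`, `E[2]` irreducible,
`ord₂ j = 1`, non-CM. DISPLAYED (as printed): the `X₀(200)`-optimality datum (`Dt`, `hopt`) and the record
`ord₂(L(200E1,1)/Ω_∞) = 0` (Cremona 1992 Tables 1 and 4: L(E,1)/Ω_BSD = S·∏c_p/#T² = 1 (Δ < 0, one real component, Ω_BSD = Ω_∞): ord₂ L^alg = 0); the odd Manin constant of Zhai's corrected statement is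
Agashe–Ribet–Stein Thm. 2.6 BY NAME (`h26`) at level `N ≤ 130000` (kernel `conductorNorm_le_200E1`). Inputs BY NAME: Zhai 2016
Thm. 1.1 (corrected, arXiv v2), Agashe–Ribet–Stein 2006 Thm. 2.6, modularity. No GZK, no reading, no instrument, no base
certificate. BSD is not proved by any of this.
[cite: Zhai2016, Thm. 1.1] [cite: AgasheRibetStein2006, Thm. 2.6] [cite: CremonaAlgorithms1997, Table 1 and Table 4] [cite: Miller2011LMS, Def. 1.1] -/
theorem printFamily200E1_lower (h11 : thm11_ordTwo_LAlg_twist_eq_zero')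
    (h26 : cremona_abs_maninConstant_eq_one_of_level_le) (hmod : hasEntireLFunction_rat)
    [hN : haveI := isElliptic_200E1; NeZero ((⟨0, 0, 0, 5, -10⟩ : WeierstrassCurve ℚ).conductorNorm ℤ)]
    (Dt : haveI := isElliptic_200E1; ModularParametrizationData (⟨0, 0, 0, 5, -10⟩ : WeierstrassCurve ℚ) ((⟨0, 0, 0, 5, -10⟩ : WeierstrassCurve ℚ).conductorNorm ℤ))
    (hopt : haveI := isElliptic_200E1; Zhai2021.IsOptimalDatum (⟨0, 0, 0, 5, -10⟩ : WeierstrassCurve ℚ) Dt)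
    (hL : haveI := isElliptic_200E1; ∃ x : ℚ, IsLAlg (⟨0, 0, 0, 5, -10⟩ : WeierstrassCurve ℚ) x ∧ x ≠ 0 ∧ padicValRat 2 x = 0)
    (F : Type) [Field F] [NumberField F] (hF : IsTwoDivisionField (⟨0, 0, 0, 5, -10⟩ : WeierstrassCurve ℚ) F)
    (M : ℤ) (hsq : Squarefree M) (hM4 : M % 4 = 1)
    (hgcd : haveI := isElliptic_200E1; Int.gcd M ((⟨0, 0, 0, 5, -10⟩ : WeierstrassCurve ℚ).conductorNorm ℤ) = 1)
    (hne : M.natAbs.primeFactors.Nonempty) (hin : ∀ q ∈ M.natAbs.primeFactors, q ≠ 2 ∧ IsInertIn F q)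
    (W : WeierstrassCurve ℚ) [W.IsElliptic] [W.IsGloballyMinimal]
    (hW : ∃ C : VariableChange ℚ, C • (⟨0, 0, 0, 5, -10⟩ : WeierstrassCurve ℚ).quadraticTwist (M : ℚ) = W) :
    haveI : Fact (Nat.Prime 2) := ⟨Nat.prime_two⟩
    W.analyticRank = 0 ∧ Addv W 2 ∧ 0 ≤ padicValRat 2 W.j ∧ ¬ W.HasCM ∧ Irr W 2 ∧ MissingLowerBoundAt W 2 := by
  haveI := isElliptic_200E1; haveI := isGloballyMinimal_200E1
  exact printFamilyZhai11'_lower_of_level_le h11 h26 hmod _ conductorNorm_le_200E1 Dt hopt Δ_sign_200E1 irr_two_200E1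
    (by rw [padicValRat_j_200E1]) (by rw [padicValRat_j_200E1]; norm_num) not_hasCM_200E1 hL F hF M hsq hM4
    hgcd hne hin W hW

end Base200E1

/-! ## Base `116B1` = `[0, 1, 0, -4, 4]` (Cremona 1992 Table 1: `N = 116 = 2²·29`, `r = 0`, `#T = 3`, `c_p = (3, 1)`, Kodaira `IV*, I₁`;
Table 4: `S = 1`), `Δ = -7424` (-), `j = -35152/29` (`ord₂ j = 4`), Zhai Thm. 1.1 -/
section Base116B1

/-- `116B1 = [0, 1, 0, -4, 4]` is an elliptic curve (`Δ = -7424 ≠ 0`). [cite: CremonaAlgorithms1997, Table 1] -/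
theorem isElliptic_116B1 : (⟨0, 1, 0, -4, 4⟩ : WeierstrassCurve ℚ).IsElliptic := ⟨by
  rw [isUnit_iff_ne_zero]; norm_num [WeierstrassCurve.Δ, WeierstrassCurve.b₂, WeierstrassCurve.b₄, WeierstrassCurve.b₆, WeierstrassCurve.b₈]⟩

/-- `116B1` is GLOBALLY MINIMAL (`|Δ| = 7424`: `v_p Δ < 12` at every prime; Kraus at `2`, Silverman at odd `p`).
[cite: SilvermanAEC2009, VII.1 Remark 1.1] [cite: Kraus1989, Prop. 1 and Prop. 2] -/
theorem isGloballyMinimal_116B1 : (⟨0, 1, 0, -4, 4⟩ : WeierstrassCurve ℚ).IsGloballyMinimal :=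
  isGloballyMinimal_of_krausCriterion_support (0) (1) (0) (-4) (4) [(2, 0, 8), (29, 0, 1)]
    (by intro t ht; simp only [List.mem_cons, List.not_mem_nil, or_false] at ht
        rcases ht with rfl | rfl <;> norm_num)
    (by decide +kernel) (by decide +kernel)

/-- `Δ(116B1) = -7424` on the integer model. [cite: CremonaAlgorithms1997, Table 1] -/
theorem M116B1_Δ : (⟨0, 1, 0, -4, 4⟩ : WeierstrassCurve ℤ).Δ = -7424 := by decide +kernel
/-- `c₄(116B1) = 208` on the integer model. [cite: CremonaAlgorithms1997, Table 1] -/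
theorem M116B1_c₄ : (⟨0, 1, 0, -4, 4⟩ : WeierstrassCurve ℤ).c₄ = 208 := by decide +kernel
/-- `Δ(116B1) < 0` (rational model). [cite: CremonaAlgorithms1997, Table 1] -/
theorem Δ_sign_116B1 : (⟨0, 1, 0, -4, 4⟩ : WeierstrassCurve ℚ).Δ < 0 := by
  norm_num [WeierstrassCurve.Δ, WeierstrassCurve.b₂, WeierstrassCurve.b₄, WeierstrassCurve.b₆, WeierstrassCurve.b₈]

/-- The integer model of `116B1` is Cremona's. [cite: SilvermanAEC2009, VIII.8] -/
theorem intModel_116B1 :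
    haveI := isElliptic_116B1; haveI := isGloballyMinimal_116B1
    integralModelInt (⟨0, 1, 0, -4, 4⟩ : WeierstrassCurve ℚ) = (⟨0, 1, 0, -4, 4⟩ : WeierstrassCurve ℤ) :=
  haveI := isElliptic_116B1; haveI := isGloballyMinimal_116B1
  integralModelInt_eq_of_map_eq _ (by ext <;> simp [WeierstrassCurve.map])

/-- `b₂, b₄, b₆` of `116B1`. [cite: SilvermanAEC2009, III.1] -/
theorem b_116B1 : (⟨0, 1, 0, -4, 4⟩ : WeierstrassCurve ℚ).b₂ = ((4 : ℤ) : ℚ) ∧ (⟨0, 1, 0, -4, 4⟩ : WeierstrassCurve ℚ).b₄ = ((-8 : ℤ) : ℚ) ∧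
    (⟨0, 1, 0, -4, 4⟩ : WeierstrassCurve ℚ).b₆ = ((16 : ℤ) : ℚ) := by
  simp only [WeierstrassCurve.b₂, WeierstrassCurve.b₄, WeierstrassCurve.b₆]; norm_num

/-- **`E[2]` irreducible for `116B1`** (`E[2](ℚ) = 0`): the monic `2`-division cubic `X³ + b₂X² + 8b₄X + 16b₆` has no root
modulo `3`. [cite: SilvermanAEC2009, III.2.3 (b)] [cite: Zhai2016, Thm. 1.1 (hypothesis E[2](ℚ) = 0)] -/
theorem irr_two_116B1 :
    haveI := isElliptic_116B1
    Irr (⟨0, 1, 0, -4, 4⟩ : WeierstrassCurve ℚ) 2 :=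
  haveI := isElliptic_116B1
  irr_two_of_forall_cubic_ne _ b_116B1.1 b_116B1.2.1 b_116B1.2.2 (ℓ := 3) (by decide)

/-- **`ord₂ j(116B1) = 4`** (`2⁴ ∥ c₄ = 208`, `2^8 ∥ Δ`): inside the window `[1, 11]`, so `116B1` and every twist
`116B1^{(M)}` are ADDITIVE and POTENTIALLY GOOD at `2`. [cite: SilvermanAEC2009, III.1 and VII.5 Prop. 5.5] -/
theorem padicValRat_j_116B1 :
    haveI := isElliptic_116B1
    padicValRat 2 (⟨0, 1, 0, -4, 4⟩ : WeierstrassCurve ℚ).j = 4 := by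
  haveI : Fact (Nat.Prime 2) := ⟨Nat.prime_two⟩
  haveI := isElliptic_116B1; haveI := isGloballyMinimal_116B1
  rw [AdditivePotMult.padicValRat_j_eq_of_intModel intModel_116B1 2 4 8 (by rw [M116B1_c₄]; decide) (by rw [M116B1_c₄]; decide)
    (by rw [M116B1_Δ]; decide) (by rw [M116B1_Δ]; decide)]
  norm_num

/-- **`N(116B1) ∣ |Δ_min| = 7424`** (the conductor divides the minimal discriminant). [cite: SilvermanAEC2009, VIII.11 and C.16] -/
theorem conductorNorm_dvd_116B1 :
    haveI := isElliptic_116B1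
    (⟨0, 1, 0, -4, 4⟩ : WeierstrassCurve ℚ).conductorNorm ℤ ∣ 7424 := by
  haveI := isElliptic_116B1; haveI := isGloballyMinimal_116B1
  have hdvd := WeierstrassCurve.conductorNorm_dvd_minimalDiscriminantNorm (⟨0, 1, 0, -4, 4⟩ : WeierstrassCurve ℚ)
    (WeierstrassCurve.finite_setOf_ordMinimalDiscriminant_ne_zero_holds _)
  rw [WeierstrassCurve.minimalDiscriminantNorm_int_eq_natAbs_minimalDiscriminantInt_holds,
    minimalDiscriminantInt_eq intModel_116B1, M116B1_Δ] at hdvd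
  exact hdvd

/-- **`N(116B1) ≤ 130000`** (`N ∣ 7424`; Cremona: `N = 116`, not needed) — the level bound feeding Agashe–Ribet–Stein Thm. 2.6.
[cite: AgasheRibetStein2006, Thm. 2.6] -/
theorem conductorNorm_le_116B1 :
    haveI := isElliptic_116B1
    (⟨0, 1, 0, -4, 4⟩ : WeierstrassCurve ℚ).conductorNorm ℤ ≤ 130000 :=
  le_trans (Nat.le_of_dvd (by norm_num) conductorNorm_dvd_116B1) (by norm_num)
/-- **`116B1` is non-CM**: multiplicative at `29` (`29 ∣ Δ`, `29 ∤ c₄`), so `ord_29 j < 0` and `j` is not a CM invariant. [cite: SilvermanAEC2009, App. C §11] -/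
theorem not_hasCM_116B1 :
    haveI := isElliptic_116B1
    ¬ (⟨0, 1, 0, -4, 4⟩ : WeierstrassCurve ℚ).HasCM := by
  haveI : Fact (Nat.Prime 2) := ⟨Nat.prime_two⟩
  haveI := isElliptic_116B1; haveI := isGloballyMinimal_116B1
  haveI : Fact (Nat.Prime 29) := ⟨by norm_num⟩
  exact AdditivePotMult.not_hasCM_of_padicValRat_j_neg (p := 29) (EisensteinPrimes.padicValRat_j_neg_of_mult _ 29
    (hasMultiplicativeReductionAtPrime_of_intModel intModel_116B1 29 (by rw [M116B1_Δ]; decide) (by rw [M116B1_c₄]; decide)))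

/-- **THE ZHAI-1.1 ROAD AT THE BASE `116B1`**: for every `M` as in Zhai 2016 Thm. 1.1 (square-free,
`M ≡ 1 (mod 4)`, `(M, N) = 1`, `r ≥ 1` odd prime factors all inert in the cubic `2`-division field `F` of `116B1`) and every global
minimal `W ≅ 116B1^{(M)}`: `r_an(W) = 0`, `W` is ADDITIVE and POTENTIALLY GOOD at `2`, NON-CM, `W[2]` IRREDUCIBLE, and the LOWER
half `MissingLowerBoundAt W 2` of BSD₂ HOLDS. KERNEL: ellipticity, global minimality, `Δ < 0`, `E[2]` irreducible,
`ord₂ j = 4`, non-CM. DISPLAYED (as printed): the `X₀(116)`-optimality datum (`Dt`, `hopt`) and the record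
`ord₂(L(116B1,1)/Ω_∞) = 0` (Cremona 1992 Tables 1 and 4: L(E,1)/Ω_BSD = S·∏c_p/#T² = 3/9 (Δ < 0, one real component, Ω_BSD = Ω_∞): ord₂ L^alg = 0); the odd Manin constant of Zhai's corrected statement is
Agashe–Ribet–Stein Thm. 2.6 BY NAME (`h26`) at level `N ≤ 130000` (kernel `conductorNorm_le_116B1`). Inputs BY NAME: Zhai 2016
Thm. 1.1 (corrected, arXiv v2), Agashe–Ribet–Stein 2006 Thm. 2.6, modularity. No GZK, no reading, no instrument, no base
certificate. BSD is not proved by any of this.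
[cite: Zhai2016, Thm. 1.1] [cite: AgasheRibetStein2006, Thm. 2.6] [cite: CremonaAlgorithms1997, Table 1 and Table 4] [cite: Miller2011LMS, Def. 1.1] -/
theorem printFamily116B1_lower (h11 : thm11_ordTwo_LAlg_twist_eq_zero')
    (h26 : cremona_abs_maninConstant_eq_one_of_level_le) (hmod : hasEntireLFunction_rat)
    [hN : haveI := isElliptic_116B1; NeZero ((⟨0, 1, 0, -4, 4⟩ : WeierstrassCurve ℚ).conductorNorm ℤ)]
    (Dt : haveI := isElliptic_116B1; ModularParametrizationData (⟨0, 1, 0, -4, 4⟩ : WeierstrassCurve ℚ) ((⟨0, 1, 0, -4, 4⟩ : WeierstrassCurve ℚ).conductorNorm ℤ))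
    (hopt : haveI := isElliptic_116B1; Zhai2021.IsOptimalDatum (⟨0, 1, 0, -4, 4⟩ : WeierstrassCurve ℚ) Dt)
    (hL : haveI := isElliptic_116B1; ∃ x : ℚ, IsLAlg (⟨0, 1, 0, -4, 4⟩ : WeierstrassCurve ℚ) x ∧ x ≠ 0 ∧ padicValRat 2 x = 0)
    (F : Type) [Field F] [NumberField F] (hF : IsTwoDivisionField (⟨0, 1, 0, -4, 4⟩ : WeierstrassCurve ℚ) F)
    (M : ℤ) (hsq : Squarefree M) (hM4 : M % 4 = 1)
    (hgcd : haveI := isElliptic_116B1; Int.gcd M ((⟨0, 1, 0, -4, 4⟩ : WeierstrassCurve ℚ).conductorNorm ℤ) = 1)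
    (hne : M.natAbs.primeFactors.Nonempty) (hin : ∀ q ∈ M.natAbs.primeFactors, q ≠ 2 ∧ IsInertIn F q)
    (W : WeierstrassCurve ℚ) [W.IsElliptic] [W.IsGloballyMinimal]
    (hW : ∃ C : VariableChange ℚ, C • (⟨0, 1, 0, -4, 4⟩ : WeierstrassCurve ℚ).quadraticTwist (M : ℚ) = W) :
    haveI : Fact (Nat.Prime 2) := ⟨Nat.prime_two⟩
    W.analyticRank = 0 ∧ Addv W 2 ∧ 0 ≤ padicValRat 2 W.j ∧ ¬ W.HasCM ∧ Irr W 2 ∧ MissingLowerBoundAt W 2 := by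
  haveI := isElliptic_116B1; haveI := isGloballyMinimal_116B1
  exact printFamilyZhai11'_lower_of_level_le h11 h26 hmod _ conductorNorm_le_116B1 Dt hopt Δ_sign_116B1 irr_two_116B1
    (by rw [padicValRat_j_116B1]; norm_num) (by rw [padicValRat_j_116B1]; norm_num) not_hasCM_116B1 hL F hF M hsq hM4
    hgcd hne hin W hW

end Base116B1

/-! ## Base `540A1` = `[0, 0, 0, -33, 73]` (Cremona 1992 Table 1: `N = 540 = 2²·3³·5`, `r = 0`, `#T = 3`, `c_p = (3, 1, 1)`, Kodaira `IV, II, I₁`;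
Table 4: `S = 1`), `Δ = -2160` (-), `j = -9199872/5` (`ord₂ j = 8`), Zhai Thm. 1.1 -/
section Base540A1

/-- `540A1 = [0, 0, 0, -33, 73]` is an elliptic curve (`Δ = -2160 ≠ 0`). [cite: CremonaAlgorithms1997, Table 1] -/
theorem isElliptic_540A1 : (⟨0, 0, 0, -33, 73⟩ : WeierstrassCurve ℚ).IsElliptic := ⟨by
  rw [isUnit_iff_ne_zero]; norm_num [WeierstrassCurve.Δ, WeierstrassCurve.b₂, WeierstrassCurve.b₄, WeierstrassCurve.b₆, WeierstrassCurve.b₈]⟩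

/-- `540A1` is GLOBALLY MINIMAL (`|Δ| = 2160`: `v_p Δ < 12` at every prime; Kraus at `2`, Silverman at odd `p`).
[cite: SilvermanAEC2009, VII.1 Remark 1.1] [cite: Kraus1989, Prop. 1 and Prop. 2] -/
theorem isGloballyMinimal_540A1 : (⟨0, 0, 0, -33, 73⟩ : WeierstrassCurve ℚ).IsGloballyMinimal :=
  isGloballyMinimal_of_krausCriterion_support (0) (0) (0) (-33) (73) [(2, 0, 4), (3, 0, 3), (5, 0, 1)]
    (by intro t ht; simp only [List.mem_cons, List.not_mem_nil, or_false] at ht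
        rcases ht with rfl | rfl | rfl <;> norm_num)
    (by decide +kernel) (by decide +kernel)

/-- `Δ(540A1) = -2160` on the integer model. [cite: CremonaAlgorithms1997, Table 1] -/
theorem M540A1_Δ : (⟨0, 0, 0, -33, 73⟩ : WeierstrassCurve ℤ).Δ = -2160 := by decide +kernel
/-- `c₄(540A1) = 1584` on the integer model. [cite: CremonaAlgorithms1997, Table 1] -/
theorem M540A1_c₄ : (⟨0, 0, 0, -33, 73⟩ : WeierstrassCurve ℤ).c₄ = 1584 := by decide +kernel
/-- `Δ(540A1) < 0` (rational model). [cite: CremonaAlgorithms1997, Table 1] -/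
theorem Δ_sign_540A1 : (⟨0, 0, 0, -33, 73⟩ : WeierstrassCurve ℚ).Δ < 0 := by
  norm_num [WeierstrassCurve.Δ, WeierstrassCurve.b₂, WeierstrassCurve.b₄, WeierstrassCurve.b₆, WeierstrassCurve.b₈]

/-- The integer model of `540A1` is Cremona's. [cite: SilvermanAEC2009, VIII.8] -/
theorem intModel_540A1 :
    haveI := isElliptic_540A1; haveI := isGloballyMinimal_540A1
    integralModelInt (⟨0, 0, 0, -33, 73⟩ : WeierstrassCurve ℚ) = (⟨0, 0, 0, -33, 73⟩ : WeierstrassCurve ℤ) :=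
  haveI := isElliptic_540A1; haveI := isGloballyMinimal_540A1
  integralModelInt_eq_of_map_eq _ (by ext <;> simp [WeierstrassCurve.map])

/-- `b₂, b₄, b₆` of `540A1`. [cite: SilvermanAEC2009, III.1] -/
theorem b_540A1 : (⟨0, 0, 0, -33, 73⟩ : WeierstrassCurve ℚ).b₂ = ((0 : ℤ) : ℚ) ∧ (⟨0, 0, 0, -33, 73⟩ : WeierstrassCurve ℚ).b₄ = ((-66 : ℤ) : ℚ) ∧
    (⟨0, 0, 0, -33, 73⟩ : WeierstrassCurve ℚ).b₆ = ((292 : ℤ) : ℚ) := by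
  simp only [WeierstrassCurve.b₂, WeierstrassCurve.b₄, WeierstrassCurve.b₆]; norm_num

/-- **`E[2]` irreducible for `540A1`** (`E[2](ℚ) = 0`): the monic `2`-division cubic `X³ + b₂X² + 8b₄X + 16b₆` has no root
modulo `17`. [cite: SilvermanAEC2009, III.2.3 (b)] [cite: Zhai2016, Thm. 1.1 (hypothesis E[2](ℚ) = 0)] -/
theorem irr_two_540A1 :
    haveI := isElliptic_540A1
    Irr (⟨0, 0, 0, -33, 73⟩ : WeierstrassCurve ℚ) 2 :=
  haveI := isElliptic_540A1
  irr_two_of_forall_cubic_ne _ b_540A1.1 b_540A1.2.1 b_540A1.2.2 (ℓ := 17) (by decide)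

/-- **`ord₂ j(540A1) = 8`** (`2⁴ ∥ c₄ = 1584`, `2^4 ∥ Δ`): inside the window `[1, 11]`, so `540A1` and every twist
`540A1^{(M)}` are ADDITIVE and POTENTIALLY GOOD at `2`. [cite: SilvermanAEC2009, III.1 and VII.5 Prop. 5.5] -/
theorem padicValRat_j_540A1 :
    haveI := isElliptic_540A1
    padicValRat 2 (⟨0, 0, 0, -33, 73⟩ : WeierstrassCurve ℚ).j = 8 := by
  haveI : Fact (Nat.Prime 2) := ⟨Nat.prime_two⟩
  haveI := isElliptic_540A1; haveI := isGloballyMinimal_540A1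
  rw [AdditivePotMult.padicValRat_j_eq_of_intModel intModel_540A1 2 4 4 (by rw [M540A1_c₄]; decide) (by rw [M540A1_c₄]; decide)
    (by rw [M540A1_Δ]; decide) (by rw [M540A1_Δ]; decide)]
  norm_num

/-- **`N(540A1) ∣ |Δ_min| = 2160`** (the conductor divides the minimal discriminant). [cite: SilvermanAEC2009, VIII.11 and C.16] -/
theorem conductorNorm_dvd_540A1 :
    haveI := isElliptic_540A1
    (⟨0, 0, 0, -33, 73⟩ : WeierstrassCurve ℚ).conductorNorm ℤ ∣ 2160 := by
  haveI := isElliptic_540A1; haveI := isGloballyMinimal_540A1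
  have hdvd := WeierstrassCurve.conductorNorm_dvd_minimalDiscriminantNorm (⟨0, 0, 0, -33, 73⟩ : WeierstrassCurve ℚ)
    (WeierstrassCurve.finite_setOf_ordMinimalDiscriminant_ne_zero_holds _)
  rw [WeierstrassCurve.minimalDiscriminantNorm_int_eq_natAbs_minimalDiscriminantInt_holds,
    minimalDiscriminantInt_eq intModel_540A1, M540A1_Δ] at hdvd
  exact hdvd

/-- **`N(540A1) ≤ 130000`** (`N ∣ 2160`; Cremona: `N = 540`, not needed) — the level bound feeding Agashe–Ribet–Stein Thm. 2.6.
[cite: AgasheRibetStein2006, Thm. 2.6] -/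
theorem conductorNorm_le_540A1 :
    haveI := isElliptic_540A1
    (⟨0, 0, 0, -33, 73⟩ : WeierstrassCurve ℚ).conductorNorm ℤ ≤ 130000 :=
  le_trans (Nat.le_of_dvd (by norm_num) conductorNorm_dvd_540A1) (by norm_num)
/-- **`540A1` is non-CM**: `ord₂ j = 8 ∈ {1,2,5,7,8,9,10,11}` (k4-w1's window: no CM `j`-invariant has such a `2`-adic valuation). [cite: SilvermanAEC2009, App. C §11] -/
theorem not_hasCM_540A1 :
    haveI := isElliptic_540A1
    ¬ (⟨0, 0, 0, -33, 73⟩ : WeierstrassCurve ℚ).HasCM := by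
  haveI : Fact (Nat.Prime 2) := ⟨Nat.prime_two⟩
  haveI := isElliptic_540A1; haveI := isGloballyMinimal_540A1
  exact not_hasCM_of_padicValRat_two_j_mem _ (by rw [padicValRat_j_540A1]; decide)

/-- **THE ZHAI-1.1 ROAD AT THE BASE `540A1`**: for every `M` as in Zhai 2016 Thm. 1.1 (square-free,
`M ≡ 1 (mod 4)`, `(M, N) = 1`, `r ≥ 1` odd prime factors all inert in the cubic `2`-division field `F` of `540A1`) and every global
minimal `W ≅ 540A1^{(M)}`: `r_an(W) = 0`, `W` is ADDITIVE and POTENTIALLY GOOD at `2`, NON-CM, `W[2]` IRREDUCIBLE, and the LOWER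
half `MissingLowerBoundAt W 2` of BSD₂ HOLDS. KERNEL: ellipticity, global minimality, `Δ < 0`, `E[2]` irreducible,
`ord₂ j = 8`, non-CM. DISPLAYED (as printed): the `X₀(540)`-optimality datum (`Dt`, `hopt`) and the record
`ord₂(L(540A1,1)/Ω_∞) = 0` (Cremona 1992 Tables 1 and 4: L(E,1)/Ω_BSD = S·∏c_p/#T² = 3/9 (Δ < 0, one real component, Ω_BSD = Ω_∞): ord₂ L^alg = 0); the odd Manin constant of Zhai's corrected statement is
Agashe–Ribet–Stein Thm. 2.6 BY NAME (`h26`) at level `N ≤ 130000` (kernel `conductorNorm_le_540A1`). Inputs BY NAME: Zhai 2016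
Thm. 1.1 (corrected, arXiv v2), Agashe–Ribet–Stein 2006 Thm. 2.6, modularity. No GZK, no reading, no instrument, no base
certificate. BSD is not proved by any of this.
[cite: Zhai2016, Thm. 1.1] [cite: AgasheRibetStein2006, Thm. 2.6] [cite: CremonaAlgorithms1997, Table 1 and Table 4] [cite: Miller2011LMS, Def. 1.1] -/
theorem printFamily540A1_lower (h11 : thm11_ordTwo_LAlg_twist_eq_zero')
    (h26 : cremona_abs_maninConstant_eq_one_of_level_le) (hmod : hasEntireLFunction_rat)
    [hN : haveI := isElliptic_540A1; NeZero ((⟨0, 0, 0, -33, 73⟩ : WeierstrassCurve ℚ).conductorNorm ℤ)]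
    (Dt : haveI := isElliptic_540A1; ModularParametrizationData (⟨0, 0, 0, -33, 73⟩ : WeierstrassCurve ℚ) ((⟨0, 0, 0, -33, 73⟩ : WeierstrassCurve ℚ).conductorNorm ℤ))
    (hopt : haveI := isElliptic_540A1; Zhai2021.IsOptimalDatum (⟨0, 0, 0, -33, 73⟩ : WeierstrassCurve ℚ) Dt)
    (hL : haveI := isElliptic_540A1; ∃ x : ℚ, IsLAlg (⟨0, 0, 0, -33, 73⟩ : WeierstrassCurve ℚ) x ∧ x ≠ 0 ∧ padicValRat 2 x = 0)
    (F : Type) [Field F] [NumberField F] (hF : IsTwoDivisionField (⟨0, 0, 0, -33, 73⟩ : WeierstrassCurve ℚ) F)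
    (M : ℤ) (hsq : Squarefree M) (hM4 : M % 4 = 1)
    (hgcd : haveI := isElliptic_540A1; Int.gcd M ((⟨0, 0, 0, -33, 73⟩ : WeierstrassCurve ℚ).conductorNorm ℤ) = 1)
    (hne : M.natAbs.primeFactors.Nonempty) (hin : ∀ q ∈ M.natAbs.primeFactors, q ≠ 2 ∧ IsInertIn F q)
    (W : WeierstrassCurve ℚ) [W.IsElliptic] [W.IsGloballyMinimal]
    (hW : ∃ C : VariableChange ℚ, C • (⟨0, 0, 0, -33, 73⟩ : WeierstrassCurve ℚ).quadraticTwist (M : ℚ) = W) :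
    haveI : Fact (Nat.Prime 2) := ⟨Nat.prime_two⟩
    W.analyticRank = 0 ∧ Addv W 2 ∧ 0 ≤ padicValRat 2 W.j ∧ ¬ W.HasCM ∧ Irr W 2 ∧ MissingLowerBoundAt W 2 := by
  haveI := isElliptic_540A1; haveI := isGloballyMinimal_540A1
  exact printFamilyZhai11'_lower_of_level_le h11 h26 hmod _ conductorNorm_le_540A1 Dt hopt Δ_sign_540A1 irr_two_540A1
    (by rw [padicValRat_j_540A1]; norm_num) (by rw [padicValRat_j_540A1]; norm_num) not_hasCM_540A1 hL F hF M hsq hM4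
    hgcd hne hin W hW

end Base540A1

end Summit.BirchSwinnertonDyer.BirchSwinnertonDyer.Theorems.AddPotGoodPrint

end
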